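import Literature.Probability.RandomPlanarGeometry.SAWEndpointKestenInequalityZd
import Literature.Probability.RandomPlanarGeometry.SAWPolygonRatioRateZd
import HarnessLib

/-!
# CriticalPhenomena/PercolationContinuityZ3 — Theorems/PercNearOneGluingNoHeavyPcintPriceLawFamily.lean:
# the graded NEAR family of self-avoiding walks (states of the memory automaton), swap-closed, with its envelopes

Lane prim-pcint, STRUCTURE conjecture **C3 (i) PRICE LAW**.  The near family at memory `2k` on `ℤ^{d+2}`:
`nearFam d k = {(m, ω) : m < 2k, ω ∈ S_m, ‖ω(m)‖₁ ≤ 2k − m}` (vertex-function model `SAW.Zd.saws`), whose cardinality is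
the state count `memStates (d+2) (2k)` of `…PcintClassCountLaw.lean` (the identification is made in `…PcintPriceLaw.lean`).
Proved here: membership / cardinality bookkeeping; CLOSURE under Kesten's swap `(U,Q) ↔ (V,Q)` (the swap keeps the
endpoint, `EndpointRatioZd.insV_apply_end'`, and changes the length by `2`, so `length + ‖end‖₁` moves by exactly `2`);
the lower envelope `e^{-c√k} μ^{2k} ≤ |nearFam d k|` (the closing walks of length `2k−1`, Madras–Slade Corollary 3.2.5 /
(3.2.8), `MadrasSlade1993_cor325_lower_general`) and the Hammersley–Welsh upper bounds
`c_m ≤ 2k e^{6√(2k)} μ^{2k}` (`m < 2k`), `|nearFam d k| ≤ (2k)² e^{6√(2k)} μ^{2k}`.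

Source: N. Madras, G. Slade, *The Self-Avoiding Walk* (1993), §3.1 Theorem 3.1.1, §3.2 Corollary 3.2.5, §7.3 proof of
Theorem 7.3.2 (case (c): families closed under the swap) [MadrasSlade1993].  Written by prim-pcint-2 gen 14, 2026-08-23.
-/

noncomputable section

open Filter Topology Literature.Probability.LatticeModels
open Literature.Probability.RandomPlanarGeometry.SAW.Zd
open scoped BigOperators

namespace Summit.CriticalPhenomena.PercolationContinuityZ3.Theorems.Pcint.MemoryTail

variable {d : ℕ}

/-! ### The near family (function model) -/

open Classical in
/-- The near self-avoiding walks of length `m` for memory `τ` on `ℤ^{d+2}`, vertex-function model: `ω ∈ S_m` with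
`‖ω(m)‖₁ ≤ τ − m`. [folklore] -/
def nearFun (d τ m : ℕ) : Finset (ℕ → Site (d + 2)) :=
  (saws (d + 2) m).filter fun ω => normOne (ω m) ≤ τ - m

/-- The GRADED near family at memory `2k`: pairs `(m, ω)` with `m < 2k` and `ω ∈ nearFun d (2k) m`. [folklore] -/
def nearFam (d k : ℕ) : Finset (ℕ × (ℕ → Site (d + 2))) :=
  ((Finset.range (2 * k)).sigma fun m => nearFun d (2 * k) m).map
    (Equiv.sigmaEquivProd ℕ (ℕ → Site (d + 2))).toEmbedding

/-- Membership in `nearFun`. [folklore] -/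
theorem mem_nearFun {τ m : ℕ} {ω : ℕ → Site (d + 2)} :
    ω ∈ nearFun d τ m ↔ ω ∈ saws (d + 2) m ∧ normOne (ω m) ≤ τ - m := by
  classical
  unfold nearFun
  rw [Finset.mem_filter]

/-- Membership in `nearFam`. [folklore] -/
theorem mem_nearFam {k : ℕ} {p : ℕ × (ℕ → Site (d + 2))} :
    p ∈ nearFam d k ↔ p.1 < 2 * k ∧ p.2 ∈ nearFun d (2 * k) p.1 := by
  unfold nearFam
  rw [Finset.mem_map]
  constructor
  · rintro ⟨⟨m, ω⟩, hq, rfl⟩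
    rw [Finset.mem_sigma, Finset.mem_range] at hq
    exact hq
  · rintro ⟨h1, h2⟩
    refine ⟨⟨p.1, p.2⟩, ?_, rfl⟩
    rw [Finset.mem_sigma, Finset.mem_range]
    exact ⟨h1, h2⟩

/-- `|nearFam d k| = Σ_{m<2k} |nearFun d (2k) m|`. [folklore] -/
theorem card_nearFam (d k : ℕ) :
    (nearFam d k).card = ∑ m ∈ Finset.range (2 * k), (nearFun d (2 * k) m).card := by
  unfold nearFam
  rw [Finset.card_map, Finset.card_sigma]

/-- Lengths at level `k` are `< 2k`. [folklore] -/
theorem length_lt_of_mem_nearFam {k : ℕ} {p : ℕ × (ℕ → Site (d + 2))} (hp : p ∈ nearFam d k) :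
    p.1 + 1 ≤ 2 * k := (mem_nearFam.1 hp).1

/-- Members are self-avoiding walks of their own length. [folklore] -/
theorem mem_saws_of_mem_nearFam {k : ℕ} {p : ℕ × (ℕ → Site (d + 2))} (hp : p ∈ nearFam d k) :
    p.2 ∈ saws (d + 2) p.1 := (mem_nearFun.1 (mem_nearFam.1 hp).2).1

/-- The empty walk `(0, 0)` is a member for `k ≥ 1`; in particular `nearFam d k ≠ ∅`. [folklore] -/
theorem card_nearFam_pos {k : ℕ} (hk : 1 ≤ k) : 0 < (nearFam d k).card := by
  refine Finset.card_pos.2 ⟨(0, fun _ => 0), mem_nearFam.2 ⟨by simp only; omega, mem_nearFun.2 ⟨?_, ?_⟩⟩⟩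
  · rw [mem_saws]
    refine ⟨rfl, fun i _ => rfl, fun i hi => absurd hi (Nat.not_lt_zero i), fun i hi j hj _ => ?_⟩
    simp only [Set.mem_setOf_eq, Nat.le_zero] at hi hj
    rw [hi, hj]
  · simp [normOne]

/-! ### Closure under Kesten's swap -/

/-- **Insertion keeps nearness**: swapping an occurrence of `(U,Q)` on a member of `nearFam d k` into one of `(V,Q)` gives a
member of `nearFam d (k+1)` (length `+2`, endpoint fixed). [cite: MadrasSlade1993, Theorem 7.3.2 (proof, case (c))] -/
theorem ins_mem_nearFam {k i : ℕ} {p : ℕ × (ℕ → Site (d + 2))} (hp : p ∈ nearFam d k) (hi : OccU p.1 p.2 i) :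
    (p.1 + 2, insV i p.2) ∈ nearFam d (k + 1) := by
  obtain ⟨hlt, hω⟩ := mem_nearFam.1 hp
  obtain ⟨hsaw, hnear⟩ := mem_nearFun.1 hω
  refine mem_nearFam.2 ⟨by simp only; omega, mem_nearFun.2 ⟨insV_mem_saws hsaw hi, ?_⟩⟩
  simp only
  rw [EndpointRatioZd.insV_apply_end' hi]
  omega

/-- **Deletion keeps nearness**: the inverse swap on a member of `nearFam d (k+1)` gives a member of `nearFam d k`.
[cite: MadrasSlade1993, Theorem 7.3.2 (proof, case (c))] -/
theorem del_mem_nearFam {k i : ℕ} {p : ℕ × (ℕ → Site (d + 2))} (hp : p ∈ nearFam d (k + 1)) (hi : OccV p.1 p.2 i) :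
    (p.1 - 2, delV i p.2) ∈ nearFam d k := by
  obtain ⟨hlt, hω⟩ := mem_nearFam.1 hp
  obtain ⟨hsaw, hnear⟩ := mem_nearFun.1 hω
  obtain ⟨n, hn⟩ : ∃ n, p.1 = n + 2 := ⟨p.1 - 2, by have := hi.1; omega⟩
  have hsaw' : p.2 ∈ saws (d + 2) (n + 2) := hn ▸ hsaw
  have hi' : OccV (n + 2) p.2 i := hn ▸ hi
  have e : p.1 - 2 = n := by omega
  refine mem_nearFam.2 ⟨by simp only; omega, ?_⟩
  simp only [e]
  refine mem_nearFun.2 ⟨delV_mem_saws hsaw' hi', ?_⟩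
  rw [EndpointRatioZd.delV_apply_end' hi', ← hn]
  omega

/-! ### Envelopes -/

/-- The closing walks of length `2k−1` (to `−e₂`) are members: `c_{2k−1}(0,−e₂) ≤ |nearFam d k|` (`k ≥ 1`).
[cite: MadrasSlade1993, §3.2, eq. (3.2.1)] -/
theorem countAt_le_card_nearFam {k : ℕ} (hk : 1 ≤ k) :
    countAt (d + 2) (2 * k - 1) eNeg ≤ (nearFam d k).card := by
  classical
  rw [← card_sawFun]
  refine Finset.card_le_card_of_injOn (fun ω => (2 * k - 1, ω)) (fun ω hω => ?_) (fun a _ b _ h => by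
    simpa using congrArg Prod.snd h)
  rw [Finset.mem_coe, mem_sawFun_iff_mem_saws] at hω
  rw [Finset.mem_coe, mem_nearFam]
  refine ⟨by simp only; omega, mem_nearFun.2 ⟨hω.1, ?_⟩⟩
  dsimp only
  rw [hω.2, PolygonRatioZd.normOne_eNeg]
  omega

/-- **Lower envelope**: there is `c ≥ 0` with `e^{-c√k} μ^{2k} ≤ |nearFam d k|` for all `k ≥ 1` (Madras–Slade (3.2.8):
`μ^{2M} e^{-C√M} ≤ c_{2M+1}(0,e)`, applied with `M = k − 1`). [cite: MadrasSlade1993, Corollary 3.2.5, eq. (3.2.8)] -/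
theorem exists_lower_envelope (d : ℕ) : ∃ c : ℝ, 0 ≤ c ∧ ∀ k : ℕ, 1 ≤ k →
    Real.exp (-(c * Real.sqrt k)) * connectiveConstant (d + 2) ^ (2 * k) ≤ ((nearFam d k).card : ℝ) := by
  obtain ⟨C, hC⟩ := MadrasSlade1993_cor325_lower_general (d := d + 2) (by omega)
  set μ := connectiveConstant (d + 2) with hμ
  have hμ1 : 1 ≤ μ := one_le_connectiveConstant (d + 2)
  have hμ0 : 0 < μ := by linarith
  refine ⟨|C| + 2 * μ, by positivity, fun k hk => ?_⟩
  have hk1 : (1 : ℝ) ≤ k := by exact_mod_cast hk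
  have hsqrt1 : 1 ≤ Real.sqrt k := by rw [← Real.sqrt_one]; exact Real.sqrt_le_sqrt hk1
  have hcard1 : (1 : ℝ) ≤ (nearFam d k).card := by exact_mod_cast card_nearFam_pos hk
  -- `μ² ≤ e^{2μ}`
  have hμexp : μ ^ 2 ≤ Real.exp (2 * μ) := by
    have h1 : μ ≤ Real.exp μ := by linarith [Real.add_one_le_exp μ]
    calc μ ^ 2 ≤ Real.exp μ ^ 2 := pow_le_pow_left₀ hμ0.le h1 2
      _ = Real.exp (2 * μ) := by rw [← Real.exp_nat_mul]; ring_nf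
  rcases Nat.lt_or_ge k 2 with hk2 | hk2
  · -- `k = 1`: `e^{-(|C|+2μ)} μ² ≤ 1 ≤ |nearFam|`
    have hk' : k = 1 := by omega
    subst hk'
    simp only [Nat.cast_one, Real.sqrt_one, mul_one]
    calc Real.exp (-(|C| + 2 * μ)) * μ ^ (2 * 1) ≤ Real.exp (-(2 * μ)) * μ ^ 2 := by
          rw [mul_one]
          refine mul_le_mul_of_nonneg_right (Real.exp_le_exp.2 (by linarith [abs_nonneg C])) (by positivity)
      _ ≤ 1 := by
          rw [Real.exp_neg, inv_mul_le_iff₀ (Real.exp_pos _), mul_one]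
          exact hμexp
      _ ≤ _ := hcard1
  · -- `k ≥ 2`: use (3.2.8) with `M = k - 1`
    obtain ⟨M, rfl⟩ : ∃ M, k = M + 1 := ⟨k - 1, by omega⟩
    have hM : 1 ≤ M := by omega
    have h := hC M hM
    have hmem : (countAt (d + 2) (2 * M + 1) eNeg : ℝ) ≤ (nearFam d (M + 1)).card := by
      have := countAt_le_card_nearFam (d := d) (k := M + 1) (by omega)
      rw [show 2 * (M + 1) - 1 = 2 * M + 1 by omega] at this
      exact_mod_cast this
    refine le_trans ?_ (h.trans hmem)
    -- `e^{-(|C|+2μ)√(M+1)} μ^{2M+2} ≤ μ^{2M} e^{-C√M}`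
    have hsM : Real.sqrt M ≤ Real.sqrt ((M + 1 : ℕ) : ℝ) := Real.sqrt_le_sqrt (by push_cast; linarith)
    have hsM0 : 0 ≤ Real.sqrt M := Real.sqrt_nonneg _
    have hexp : Real.exp (-((|C| + 2 * μ) * Real.sqrt ((M + 1 : ℕ) : ℝ))) * μ ^ 2 ≤
        Real.exp (-(C * Real.sqrt M)) := by
      have h1 : Real.exp (-((|C| + 2 * μ) * Real.sqrt ((M + 1 : ℕ) : ℝ))) * μ ^ 2 ≤
          Real.exp (-((|C| + 2 * μ) * Real.sqrt ((M + 1 : ℕ) : ℝ))) * Real.exp (2 * μ) :=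
        mul_le_mul_of_nonneg_left hμexp (Real.exp_pos _).le
      refine h1.trans ?_
      rw [← Real.exp_add, Real.exp_le_exp]
      have hCabs : -(C * Real.sqrt M) ≥ -(|C| * Real.sqrt M) := by
        have := mul_le_mul_of_nonneg_right (le_abs_self C) hsM0
        linarith
      have hs1 : 1 ≤ Real.sqrt ((M + 1 : ℕ) : ℝ) := le_trans hsqrt1 le_rfl
      nlinarith [abs_nonneg C, mul_le_mul_of_nonneg_left hsM (abs_nonneg C)]
    calc Real.exp (-((|C| + 2 * μ) * Real.sqrt ((M + 1 : ℕ) : ℝ))) * μ ^ (2 * (M + 1))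
        = (Real.exp (-((|C| + 2 * μ) * Real.sqrt ((M + 1 : ℕ) : ℝ))) * μ ^ 2) * μ ^ (2 * M) := by ring
      _ ≤ Real.exp (-(C * Real.sqrt M)) * μ ^ (2 * M) := mul_le_mul_of_nonneg_right hexp (by positivity)
      _ = μ ^ (2 * M) * Real.exp (-(C * Real.sqrt M)) := mul_comm _ _

/-- **Hammersley–Welsh upper bound for short lengths**: `c_m ≤ K e^{6√K} μ^K` for `m + 1 ≤ K`
(`c_m ≤ (m+1)e^{6√(m+1)} b_{m+1} ≤ (m+1) e^{6√(m+1)} μ^{m+1}`, then monotonicity in `m + 1 ≤ K`, `μ ≥ 1`).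
[cite: MadrasSlade1993, §3.1, Theorem 3.1.1 and eq. (1.2.17)] -/
theorem count_le_envelope {m K : ℕ} (hm : m + 1 ≤ K) :
    (count (d + 2) m : ℝ) ≤ K * Real.exp (6 * Real.sqrt K) * connectiveConstant (d + 2) ^ K := by
  set μ := connectiveConstant (d + 2) with hμ
  have hμ1 : 1 ≤ μ := one_le_connectiveConstant (d + 2)
  have h1 := count_le_mul_exp_mul_bridgeCount (d := d + 2) m
  have h2 : (bridgeCount (d + 2) (m + 1) : ℝ) ≤ μ ^ (m + 1) := bridgeCount_le_pow (m + 1)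
  have hmK : ((m : ℝ) + 1) ≤ K := by exact_mod_cast hm
  have h3 : Real.exp (6 * Real.sqrt (m + 1)) ≤ Real.exp (6 * Real.sqrt K) :=
    Real.exp_le_exp.2 (mul_le_mul_of_nonneg_left (Real.sqrt_le_sqrt hmK) (by norm_num))
  have h4 : μ ^ (m + 1) ≤ μ ^ K := pow_le_pow_right₀ hμ1 hm
  calc (count (d + 2) m : ℝ) ≤ (m + 1) * Real.exp (6 * Real.sqrt (m + 1)) * bridgeCount (d + 2) (m + 1) := h1
    _ ≤ (m + 1) * Real.exp (6 * Real.sqrt (m + 1)) * μ ^ (m + 1) :=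
        mul_le_mul_of_nonneg_left h2 (by positivity)
    _ ≤ K * Real.exp (6 * Real.sqrt K) * μ ^ K := by
        gcongr

/-- `|nearFun d τ m| ≤ c_m`. [folklore] -/
theorem card_nearFun_le (τ m : ℕ) : (nearFun d τ m).card ≤ count (d + 2) m := by
  classical
  rw [← card_saws]
  exact Finset.card_le_card (Finset.filter_subset _ _)

/-- **Upper envelope**: `|nearFam d k| ≤ (2k)² e^{6√(2k)} μ^{2k}`. [cite: MadrasSlade1993, §3.1, Theorem 3.1.1] -/
theorem card_nearFam_le (d k : ℕ) :
    ((nearFam d k).card : ℝ) ≤ ((2 * k : ℕ) : ℝ) ^ 2 * Real.exp (6 * Real.sqrt ((2 * k : ℕ) : ℝ)) *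
      connectiveConstant (d + 2) ^ (2 * k) := by
  rw [card_nearFam, Nat.cast_sum]
  have h : ∀ m ∈ Finset.range (2 * k), ((nearFun d (2 * k) m).card : ℝ) ≤
      ((2 * k : ℕ) : ℝ) * Real.exp (6 * Real.sqrt ((2 * k : ℕ) : ℝ)) * connectiveConstant (d + 2) ^ (2 * k) := by
    intro m hm
    rw [Finset.mem_range] at hm
    refine le_trans ?_ (count_le_envelope (d := d) (by omega : m + 1 ≤ 2 * k))
    exact_mod_cast card_nearFun_le (2 * k) m
  refine (Finset.sum_le_sum h).trans ?_
  rw [Finset.sum_const, Finset.card_range, nsmul_eq_mul]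
  ring_nf
  exact le_rfl

end Summit.CriticalPhenomena.PercolationContinuityZ3.Theorems.Pcint.MemoryTail
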